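import Mathlib
import Summits.ValiantsHypothesis.ValiantsHypothesis.Theses.GrenetZeon
import HarnessLib

/-!
# Route GrenetZeon — the Glynn point `(n, 2^{n-1})` (item stmt-ValiantsHypothesis-8067)

Glynn's formula (D. G. Glynn, *The permanent of a square matrix*, European J. Combin. 31 (2010)
1887–1891, Thm. 2.1):

  `per_n(x) = 2^{1-n} Σ_{δ ∈ {±1}^n, δ₁ = 1} (∏_k δ_k) ∏_{i=1}^n (Σ_j δ_j x_{ji})`,

read as the route's two-parameter determinantal representation: over the SEMISIMPLE commutative
ℂ-algebra `R = ℂ^{2^{n-1}}` of functions on the half cube `{δ ∈ {±1}^n : δ₁ = 1}` (here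
`(Fin (n-1) → ℤˣ) → ℂ`, `δ₁ = 1` built in by `Fin.cons 1`), the permanent is the functional
`l(r) = 2^{1-n} Σ_δ (∏_k δ_k) r(δ)` applied coefficientwise to the DIAGONAL `n × n` determinant
`∏_i (Σ_j δ_j x_{ji})` whose entries are linear forms with coefficients `δ_j ∈ R`. The proof is the
character orthogonality on `{±1}^{n-1}`: the coefficient pattern of a map `f : [n] → [n]` survives
iff every fibre of `f` over `j ≥ 2` is odd, which by the parity of `n = Σ_j |f⁻¹(j)|` forces every
fibre to be odd, hence (fibres are disjoint and exhaust `[n]`) every fibre to be a singleton, i.e.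
`f` bijective — exactly the permutations, each with weight `1`.

* `glynnPoint_proof : GlynnPoint` — the item, verbatim.

Honest framing: a classical identity formalised as route bookkeeping (the semisimple end of the
Grenet–zeon line `m · s ≈ 2^n`); no lower bound is claimed and nothing here is progress on
VP ≠ VNP. Companion file `GrenetZeonZeonPoint.lean` derives the weaker item `ZeonPoint`
(`finrank ≤ 2^n`) from this one.

## References

* D. G. Glynn, *The permanent of a square matrix*, European J. Combin. 31 (2010) 1887–1891,
  Thm. 2.1 (the formula with `δ₁ = 1`, `2^{n-1}` terms). [cite: Glynn2010, Thm. 2.1]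
* C. Brand, H. Dell, T. Husfeldt, *Extensor-coding*, STOC 2018, §3 (the zeon / extensor twin of
  the same bookkeeping; the route's item `ZeonPoint`). [cite: BrandDellHusfeldt2018, §3]
-/

set_option linter.dupNamespace false

noncomputable section

open MvPolynomial Finset

namespace Summit.ValiantsHypothesis.ValiantsHypothesis.Theorems.GrenetZeonGlynn

/-! ### §1 Character sums over `{±1}^m` -/

/-- `Σ_{u = ±1} u^e = 2` if `e` is even and `0` if `e` is odd. [folklore] -/
theorem sum_units_int_pow (e : ℕ) :
    ∑ u : ℤˣ, (((u : ℤ) : ℂ)) ^ e = if Even e then 2 else 0 := by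
  rw [UnitsInt.univ, Finset.sum_pair (by decide)]
  simp only [Units.val_one, Int.cast_one, one_pow, Units.val_neg, Int.cast_neg]
  rcases Nat.even_or_odd e with he | ho
  · rw [if_pos he, he.neg_one_pow]; norm_num
  · rw [if_neg (Nat.not_even_iff_odd.mpr ho), ho.neg_one_pow]; norm_num

/-- **Orthogonality on the cube**: `Σ_{δ ∈ {±1}^m} ∏_k δ_k^{e_k} = ∏_k (Σ_{u=±1} u^{e_k})`, hence
`= 2^m` if every `e_k` is even and `0` otherwise. [folklore] -/
theorem sum_cube_prod_pow {m : ℕ} (e : Fin m → ℕ) :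
    ∑ δ : Fin m → ℤˣ, ∏ k, (((δ k : ℤ) : ℂ)) ^ e k = if ∀ k, Even (e k) then 2 ^ m else 0 := by
  classical
  rw [← Fintype.prod_sum fun k (u : ℤˣ) => (((u : ℤ) : ℂ)) ^ e k]
  simp_rw [sum_units_int_pow]
  by_cases h : ∀ k, Even (e k)
  · rw [if_pos h, Finset.prod_congr rfl fun k _ => if_pos (h k), Finset.prod_const, Finset.card_univ,
      Fintype.card_fin]
  · rw [if_neg h]
    obtain ⟨k, hk⟩ := not_forall.mp h
    exact Finset.prod_eq_zero (Finset.mem_univ k) (if_neg hk)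

/-! ### §2 Fibres of a self-map of `[n]` -/

/-- `∏_i h(f i) = ∏_j h(j)^{|f⁻¹(j)|}`. [folklore] -/
theorem prod_comp_eq_prod_pow_card {n : ℕ} {M : Type*} [CommMonoid M] (f : Fin n → Fin n)
    (h : Fin n → M) :
    ∏ i, h (f i) = ∏ j, h j ^ (Finset.univ.filter fun i => f i = j).card := by
  rw [← Finset.prod_fiberwise' Finset.univ f h]
  exact Finset.prod_congr rfl fun j _ => Finset.prod_const _

/-- A bijection has singleton fibres. [folklore] -/
theorem card_fiber_eq_one_of_bijective {n : ℕ} {f : Fin n → Fin n} (hf : Function.Bijective f)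
    (j : Fin n) : (Finset.univ.filter fun i => f i = j).card = 1 := by
  obtain ⟨a, ha, huniq⟩ := hf.existsUnique j
  rw [Finset.card_eq_one]
  refine ⟨a, ?_⟩
  ext i
  simp only [Finset.mem_filter, Finset.mem_univ, true_and, Finset.mem_singleton]
  exact ⟨fun hi => huniq i hi, fun hi => hi ▸ ha⟩

/-- The fibre cardinalities of a self-map of `[n]` add up to `n`. [folklore] -/
theorem sum_card_fiber {n : ℕ} (f : Fin n → Fin n) :
    ∑ j, (Finset.univ.filter fun i => f i = j).card = n := by
  rw [← Finset.card_eq_sum_card_fiberwise fun i _ => Finset.mem_univ (f i), Finset.card_univ,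
    Fintype.card_fin]

/-- **Glynn's parity step**: if every fibre of `f : [m+1] → [m+1]` over `j ≥ 1` is odd then `f` is
bijective (the fibre over `0` is odd too, by the parity of `m + 1 = Σ_j |f⁻¹(j)|`; nonempty fibres
make `f` surjective, hence bijective). [cite: Glynn2010, Thm. 2.1] -/
theorem bijective_of_odd_card_fiber_succ {m : ℕ} (f : Fin (m + 1) → Fin (m + 1))
    (h : ∀ k : Fin m, Odd (Finset.univ.filter fun i => f i = k.succ).card) :
    Function.Bijective f := by
  -- the fibre over `0` is odd as well
  have h0 : Odd (Finset.univ.filter fun i => f i = 0).card := by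
    have hsum := sum_card_fiber f
    rw [Fin.sum_univ_succ] at hsum
    have hcast := congrArg (fun x : ℕ => (x : ZMod 2)) hsum
    simp only [Nat.cast_add, Nat.cast_sum, Nat.cast_one] at hcast
    have hones : ∑ k : Fin m, (((Finset.univ.filter fun i => f i = k.succ).card : ℕ) : ZMod 2) =
        (m : ZMod 2) := by
      rw [Finset.sum_congr rfl fun k _ => (ZMod.natCast_eq_one_iff_odd.mpr (h k)), Finset.sum_const,
        Finset.card_univ, Fintype.card_fin, nsmul_eq_mul, mul_one]
    rw [hones] at hcast
    apply ZMod.natCast_eq_one_iff_odd.mp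
    have : ((Finset.univ.filter fun i => f i = 0).card : ZMod 2) + (m : ZMod 2) = 1 + (m : ZMod 2) := by
      rw [hcast, add_comm]
    exact add_right_cancel this
  -- every fibre is nonempty
  have hpos : ∀ j, 0 < (Finset.univ.filter fun i => f i = j).card := by
    intro j
    refine Fin.cases h0.pos (fun k => (h k).pos) j
  have hsurj : Function.Surjective f := by
    intro j
    obtain ⟨i, hi⟩ := Finset.card_pos.mp (hpos j)
    exact ⟨i, (Finset.mem_filter.mp hi).2⟩
  exact Finite.surjective_iff_bijective.mp hsurj

/-! ### §3 Glynn's signed character average of a coefficient pattern -/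

/-- **The key evaluation**: for `f : [m+1] → [m+1]`,
`Σ_{δ ∈ {±1}^m} (∏_k δ_k) · ∏_i δ̂_{f(i)} = 2^m · [f bijective]`, where `δ̂ = (1, δ)` (`δ̂₀ = 1`).
Indeed `∏_i δ̂_{f i} = ∏_{k} δ_k^{|f⁻¹(k+1)|}`, so the summand is `∏_k δ_k^{|f⁻¹(k+1)| + 1}`, whose
cube sum is `2^m` iff all `|f⁻¹(k+1)|` are odd iff `f` is bijective. [cite: Glynn2010, Thm. 2.1] -/
theorem sum_sign_prod_cons_eq {m : ℕ} (f : Fin (m + 1) → Fin (m + 1)) :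
    ∑ δ : Fin m → ℤˣ, (∏ k, (((δ k : ℤ) : ℂ))) *
        ∏ i, ((((Fin.cons (1 : ℤˣ) δ : Fin (m + 1) → ℤˣ) (f i) : ℤ) : ℂ)) =
      if Function.Bijective f then 2 ^ m else 0 := by
  classical
  have hsummand : ∀ δ : Fin m → ℤˣ, (∏ k, (((δ k : ℤ) : ℂ))) *
      ∏ i, ((((Fin.cons (1 : ℤˣ) δ : Fin (m + 1) → ℤˣ) (f i) : ℤ) : ℂ)) =
      ∏ k, (((δ k : ℤ) : ℂ)) ^ ((Finset.univ.filter fun i => f i = k.succ).card + 1) := by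
    intro δ
    rw [prod_comp_eq_prod_pow_card f fun j => ((((Fin.cons (1 : ℤˣ) δ : Fin (m + 1) → ℤˣ) j : ℤ) : ℂ)),
      Fin.prod_univ_succ]
    simp only [Fin.cons_zero, Units.val_one, Int.cast_one, one_pow, one_mul, Fin.cons_succ]
    rw [← Finset.prod_mul_distrib]
    exact Finset.prod_congr rfl fun k _ => by rw [pow_succ, mul_comm]
  rw [Finset.sum_congr rfl fun δ _ => hsummand δ, sum_cube_prod_pow]
  have hiff : (∀ k : Fin m, Even ((Finset.univ.filter fun i => f i = k.succ).card + 1)) ↔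
      Function.Bijective f := by
    constructor
    · intro h
      exact bijective_of_odd_card_fiber_succ f fun k => by
        have := h k
        rwa [Nat.even_add_one, Nat.not_even_iff_odd] at this
    · intro hf k
      rw [card_fiber_eq_one_of_bijective hf]
      exact ⟨1, rfl⟩
  by_cases hf : Function.Bijective f
  · rw [if_pos hf, if_pos (hiff.mpr hf)]
  · rw [if_neg hf, if_neg (mt hiff.mp hf)]

/-! ### §4 Products of linear forms and their coefficients -/

/-- `∏_i X_{(g i, i)}` is the monomial with exponent `Σ_i e_{(g i, i)}`. [folklore] -/
theorem prod_X_eq_monomial {n : ℕ} {S : Type*} [CommSemiring S] (g : Fin n → Fin n) :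
    ∏ i, (X (g i, i) : MvPolynomial (Fin n × Fin n) S) =
      monomial (∑ i, Finsupp.single (g i, i) 1) 1 := by
  rw [monomial_sum_one]
  rfl

/-- **Coefficients of a product of linear forms** `∏_i (Σ_j c_j X_{(j,i)})` (coefficients `c_j` in a
commutative semiring `S`): the coefficient of `x^d` is `Σ_{g : [n] → [n], e(g) = d} ∏_i c_{g i}`.
[folklore] -/
theorem coeff_prod_sum_C_mul_X {n : ℕ} {S : Type*} [CommSemiring S] (c : Fin n → S)
    (d : Fin n × Fin n →₀ ℕ) :
    coeff d (∏ i : Fin n, ∑ j : Fin n, C (c j) * (X (j, i) : MvPolynomial (Fin n × Fin n) S)) =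
      ∑ g : Fin n → Fin n, if (∑ i, Finsupp.single (g i, i) 1) = d then ∏ i, c (g i) else 0 := by
  classical
  rw [Fintype.prod_sum fun i j => C (c j) * (X (j, i) : MvPolynomial (Fin n × Fin n) S), coeff_sum]
  refine Finset.sum_congr rfl fun g _ => ?_
  rw [Finset.prod_mul_distrib, ← map_prod C, prod_X_eq_monomial, C_mul_monomial, mul_one,
    coeff_monomial]

/-- **Coefficients of the permanent**: the coefficient of `x^d` in `per_n = Σ_σ ∏_i X_{(σ i, i)}` is
the number of permutations `σ` with exponent pattern `e(σ) = d` (so `0` or `1`). [folklore] -/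
theorem coeff_perPoly {n : ℕ} (d : Fin n × Fin n →₀ ℕ) :
    coeff d (Literature.Computability.AlgebraicComplexity.perPoly (Fin n) ℂ) =
      ∑ σ : Equiv.Perm (Fin n), if (∑ i, Finsupp.single (σ i, i) 1) = d then (1 : ℂ) else 0 := by
  classical
  rw [Literature.Computability.AlgebraicComplexity.perPoly, Matrix.permanent, coeff_sum]
  refine Finset.sum_congr rfl fun σ _ => ?_
  simp_rw [Matrix.mvPolynomialX_apply]
  rw [prod_X_eq_monomial, coeff_monomial]

/-- Summing a function of self-maps weighted by `[g bijective]` is summing over permutations.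
[folklore] -/
theorem sum_ite_bijective_eq_sum_perm {n : ℕ} (F : (Fin n → Fin n) → ℂ) :
    ∑ g : Fin n → Fin n, (if Function.Bijective g then F g else 0) =
      ∑ σ : Equiv.Perm (Fin n), F σ := by
  classical
  rw [← Finset.sum_filter]
  symm
  refine Finset.sum_bij (fun σ _ => (σ : Fin n → Fin n)) (fun σ _ => ?_) (fun σ₁ _ σ₂ _ h => ?_)
    (fun g hg => ?_) (fun σ _ => rfl)
  · exact Finset.mem_filter.mpr ⟨Finset.mem_univ _, σ.bijective⟩
  · exact Equiv.coe_fn_injective h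
  · exact ⟨Equiv.ofBijective g (Finset.mem_filter.mp hg).2, Finset.mem_univ _, rfl⟩

/-! ### §5 Glynn's formula, coefficientwise, and the item -/

/-- **Glynn's formula, coefficientwise**: with `δ̂ = (1, δ)` for `δ ∈ {±1}^m`, the signed character
average `2^{-m} Σ_δ (∏_k δ_k) · [x^d] ∏_i (Σ_j δ̂_j X_{(j,i)})` of the `d`-th coefficient (a function
of `δ`) equals the `d`-th coefficient of `per_{m+1}`. [cite: Glynn2010, Thm. 2.1] -/
theorem glynn_coeff (m : ℕ) (d : Fin (m + 1) × Fin (m + 1) →₀ ℕ) :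
    ((2 : ℂ) ^ m)⁻¹ * ∑ δ : Fin m → ℤˣ, (∏ k, (((δ k : ℤ) : ℂ))) *
        (coeff d (∏ i : Fin (m + 1), ∑ j : Fin (m + 1),
          C (fun δ' : Fin m → ℤˣ => ((((Fin.cons (1 : ℤˣ) δ' : Fin (m + 1) → ℤˣ) j : ℤ) : ℂ))) *
            (X (j, i) : MvPolynomial (Fin (m + 1) × Fin (m + 1)) ((Fin m → ℤˣ) → ℂ))) :
          (Fin m → ℤˣ) → ℂ) δ =
      coeff d (Literature.Computability.AlgebraicComplexity.perPoly (Fin (m + 1)) ℂ) := by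
  classical
  rw [coeff_prod_sum_C_mul_X, coeff_perPoly,
    ← sum_ite_bijective_eq_sum_perm
      (fun g : Fin (m + 1) → Fin (m + 1) => if (∑ i, Finsupp.single (g i, i) 1) = d then (1 : ℂ) else 0)]
  simp only [Finset.sum_apply, ite_apply, Pi.zero_apply, Finset.prod_apply, Finset.mul_sum, mul_ite,
    mul_zero]
  rw [Finset.sum_comm]
  refine Finset.sum_congr rfl fun g _ => ?_
  rw [Finset.sum_ite_irrel, Finset.sum_const_zero]
  by_cases hd : (∑ i, Finsupp.single (g i, i) 1) = d
  · rw [if_pos hd, ← Finset.mul_sum, sum_sign_prod_cons_eq g]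
    by_cases hg : Function.Bijective g
    · rw [if_pos hg, if_pos hg, if_pos hd, inv_mul_cancel₀ (pow_ne_zero _ two_ne_zero)]
    · rw [if_neg hg, if_neg hg, mul_zero]
  · rw [if_neg hd]
    split_ifs <;> rfl

open Summit.ValiantsHypothesis.ValiantsHypothesis.Theses.GrenetZeon

/-- **Item `GlynnPoint` (stmt-ValiantsHypothesis-8067), PROVED**: for every `n ≥ 1` the permanent
`per_n` is `l(det A)` coefficientwise for the diagonal `n × n` matrix `A = diag(Σ_j δ̂_j X_{(j,i)})_i`
of linear forms over the semisimple algebra `R = ℂ^{2^{n-1}}` (functions on `{±1}^{n-1}`, i.e. on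
the half cube `δ̂ = (1, δ)`), with `l(r) = 2^{1-n} Σ_δ (∏_k δ_k) r(δ)` — Glynn's formula.
[cite: Glynn2010, Thm. 2.1] -/
theorem glynnPoint_proof : GlynnPoint := by
  classical
  intro n hn
  obtain ⟨m, rfl⟩ : ∃ m, n = m + 1 := ⟨n - 1, by omega⟩
  refine ⟨(Fin m → ℤˣ) → ℂ, inferInstance, inferInstance, inferInstance, ?_, ?_⟩
  · -- `dim R = 2^m = 2^(n-1)`
    rw [Module.finrank_fintype_fun_eq_card, Fintype.card_fun, Fintype.card_units_int,
      Fintype.card_fin, Nat.add_sub_cancel]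
  · -- the functional, the matrix, and the coefficient identity
    refine ⟨{ toFun := fun r => ((2 : ℂ) ^ m)⁻¹ * ∑ δ, (∏ k, (((δ k : ℤ) : ℂ))) * r δ
              map_add' := fun r s => by
                simp only [Pi.add_apply, mul_add, Finset.sum_add_distrib]
              map_smul' := fun a r => by
                simp only [Pi.smul_apply, smul_eq_mul, RingHom.id_apply, Finset.mul_sum]
                exact Finset.sum_congr rfl fun δ _ => by ring },
      Matrix.diagonal fun i : Fin (m + 1) => ∑ j : Fin (m + 1),
        C (fun δ' : Fin m → ℤˣ => ((((Fin.cons (1 : ℤˣ) δ' : Fin (m + 1) → ℤˣ) j : ℤ) : ℂ))) *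
          X (j, i), ?_, ?_⟩
    · -- entries are linear forms
      intro i j
      rw [Matrix.diagonal_apply]
      split_ifs with hij
      · refine (totalDegree_finsetSum _ _).trans (Finset.sup_le fun k _ => ?_)
        rw [C_mul_X_eq_monomial]
        refine (totalDegree_monomial_le _ _).trans ?_
        simp
      · simp
    · -- coefficientwise `l(det A) = per`
      intro d
      rw [Matrix.det_diagonal, LinearMap.coe_mk, AddHom.coe_mk]
      exact glynn_coeff m d

end Summit.ValiantsHypothesis.ValiantsHypothesis.Theorems.GrenetZeonGlynn

end
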